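import Summits.Schanuel.Schanuel.Theorems.ZilberEacCancellingFibrePositive
import Summits.Schanuel.Schanuel.Theorems.ZilberEacRealSplitParamSwap
import Summits.Schanuel.Schanuel.Theorems.ZilberEacHyperplaneSlowDensity
import Summits.Schanuel.Schanuel.Theorems.ZilberEacCriticalFibresDensity
import HarnessLib

/-!
# Real planes in `ℂ³ × (ℂˣ)³`: the family `{x₂ = r₀x₀ + r₁x₁ + c, yⱼ = xⱼ + y₂Fⱼ(y₂)}` is dense
# OFF ONE RESONANT LINE — the master theorem for targets `Xⱼ`

Zilber's Exponential-Algebraic Closedness, case ladder (host summit Schanuel, cell `pub-schanuel`,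
seat 2, gen 15).  THE FAMILY (`F₀, F₁ ∈ ℂ[u] ∖ 0`, `eⱼ = deg Fⱼ + 1`, `r₀, r₁ ∈ ℝ ∖ 0`, one of them
irrational, `c ∈ ℂ`):

  `W = {x₂ = r₀x₀ + r₁x₁ + c,  y₀ = x₀ + y₂F₀(y₂),  y₁ = x₁ + y₂F₁(y₂)} ⊆ ℂ³ × ℂ³`.

Assembling the cell's regimes by the SIGNS of `r₀, r₁` and the resonance quantity
`S = e₀r₀ + e₁r₁`:

* `r₀, r₁ > 0`: the cancelling-fibre regime with a small exponent
  (`unprojectedDense_polyFibredGraph_hyperplane_pos`, gen 15; for the fibre `1` by the swap: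
  `unprojectedDense_polyFibredGraph_hyperplane_pos'`, and `…_pos_of_ne_zero` for any `F ≠ 0`);
* `r₀, r₁ < 0`: the slow regime (`unprojectedDense_polyFibredGraph_hyperplane`, gen 12: `λ < 0`);
* `r₀r₁ < 0`, `S ≠ 1`: the cancelling-fibre regime for the fibre `0` (`S < 1` if `r₀ < 0`, `S > 1`
  if `r₀ > 0`: `cancellingAdmissible_of_neg_pos` / `…_of_pos_neg`) or — after the coordinate swap
  `0 ↔ 1` (`polyFibredGraph_hyperplane_swap`, `unprojectedDense_compPerm_iff`) — for the fibre `1`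
  (`unprojectedDense_polyFibredGraph_cancelling_swap`);
* `r₀r₁ < 0`, `S = 1`, `e₀ = e₁`: the critical size (`unprojectedDense_polyFibredGraph_critical_fibres`,
  gen 14).

**THEOREM (`unprojectedDense_polyFibredGraph_hyperplane_offResonance`).**  `I(W ∩ Γ_exp) = I(W)`
for ALL such data except possibly on the resonant line `e₀r₀ + e₁r₁ = 1` with `r₀r₁ < 0` and
`e₀ ≠ e₁` (hypothesis `hres`).  `polyFibredGraph_hyperplane_offResonance_member_dense`: with it all
seven hypotheses of `ECCell 3 2`, not linearly split, `W ∩ Γ_exp ≠ ∅`.  Example in the mixed-sign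
super-critical range: **`sqrtTwoNegHalf_member_dense`** `{x₂ = √2x₀ - x₁/2, y₀ = x₀ + y₂², y₁ = x₁ + y₂}`.

HONEST FRAMING: one explicit 3-fold family inside the OPEN cell `EC(3,2)` (what stays open for it:
the resonant line with unequal degrees and mixed signs, vanishing coefficients `r₀r₁ = 0`, a zero
fibre polynomial in some sign ranges); `EC(3,2)` OPEN; NOT Schanuel's conjecture; EAC ⇏ SC.
-/

noncomputable section

open Complex MvPolynomial Filter Topology
open Literature.NumberTheory.Transcendental Literature.ModelTheory.Zilber
  Literature.ModelTheory.ExponentialFields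

set_option linter.dupNamespace false

namespace Summit.Schanuel.Schanuel.Theorems

section Swap

/-- **Swapping the two fibres.**  The coordinate permutation `0 ↔ 1` (on both factors of
`ℂ³ × ℂ³`) carries `W(r₁, r₀; F₁, F₀)` to `W(r₀, r₁; F₀, F₁)`. [folklore] -/
theorem polyFibredGraph_hyperplane_swap (r₀ r₁ : ℝ) (c : ℂ) (F : Fin 2 → Polynomial ℂ) :
    {z : Fin 3 ⊕ Fin 3 → ℂ | z ∘ (Equiv.sumCongr (Equiv.swap (0 : Fin 3) 1) (Equiv.swap (0 : Fin 3) 1)) ∈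
      polyFibredGraph (hyperplanePoly ![r₁, r₀] c) (fun j => X j)
        (fun j => ((F ∘ Equiv.swap (0 : Fin 2) 1) j).toMvPolynomial 0)} =
    polyFibredGraph (hyperplanePoly ![r₀, r₁] c) (fun j => X j)
      (fun j => (F j).toMvPolynomial 0) := by
  have hl : (Fin.last 2 : Fin 3) = 2 := rfl
  have hc0 : (Fin.castSucc (0 : Fin 2) : Fin 3) = 0 := rfl
  have hc1 : (Fin.castSucc (1 : Fin 2) : Fin 3) = 1 := rfl
  have hs2 : (Equiv.swap (0 : Fin 3) 1) 2 = 2 := by decide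
  have hs0 : (Equiv.swap (0 : Fin 3) 1) 0 = 1 := by decide
  have hs1 : (Equiv.swap (0 : Fin 3) 1) 1 = 0 := by decide
  have ht0 : (Equiv.swap (0 : Fin 2) 1) 0 = 1 := by decide
  have ht1 : (Equiv.swap (0 : Fin 2) 1) 1 = 0 := by decide
  ext z
  simp only [Set.mem_setOf_eq, mem_polyFibredGraph_iff, Function.comp_apply, Equiv.sumCongr_apply,
    Sum.map_inl, Sum.map_inr, eval_hyperplanePoly, ell, hl, hs2, eval_X,
    MvPolynomial.eval_toMvPolynomial, Fin.cons_zero]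
  constructor
  · rintro ⟨h2, hj⟩
    refine ⟨?_, fun j => ?_⟩
    · rw [h2, Fin.sum_univ_two, Fin.sum_univ_two]
      simp only [hc0, hc1, hs0, hs1, Matrix.cons_val_zero, Matrix.cons_val_one]
      ring
    · fin_cases j
      · simpa [hc0, hc1, hs0, hs1, ht0, ht1] using hj 1
      · simpa [hc0, hc1, hs0, hs1, ht0, ht1] using hj 0
  · rintro ⟨h2, hj⟩
    refine ⟨?_, fun j => ?_⟩
    · rw [h2, Fin.sum_univ_two, Fin.sum_univ_two]
      simp only [hc0, hc1, hs0, hs1, Matrix.cons_val_zero, Matrix.cons_val_one]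
      ring
    · fin_cases j
      · simpa [hc0, hc1, hs0, hs1, ht0, ht1] using hj 1
      · simpa [hc0, hc1, hs0, hs1, ht0, ht1] using hj 0

/-- **The cancelling-fibre regime for the fibre `j = 1`** (the swap of
`unprojectedDense_polyFibredGraph_cancelling`): `F₁ ≠ 0`, `r₁ ≠ 0`, one of `r₀, r₁` irrational, an
admissible exponent for the swapped data ⟹ `I(W ∩ Γ_exp) = I(W)`. (new)
[cite: MantovaMasser2023, §1 p.5 (the open case dim π(V) = 2 in ℂ³×ℂˣ³)] -/
theorem unprojectedDense_polyFibredGraph_cancelling_swap (F : Fin 2 → Polynomial ℂ) (hF1 : F 1 ≠ 0)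
    (r₀ r₁ : ℝ) (hr₁ : r₁ ≠ 0) (hirr : Irrational r₀ ∨ Irrational r₁) (c : ℂ)
    (hadm : ∃ β : ℝ, 0 < β ∧ β * ((F 0).natDegree + 1 : ℕ) < ((F 1).natDegree + 1 : ℕ) ∧
      (β / ((F 1).natDegree + 1 : ℕ) - r₀) / r₁ < β) :
    UnprojectedDense (polyFibredGraph (hyperplanePoly ![r₀, r₁] c) (fun j => X j)
      (fun j => (F j).toMvPolynomial 0)) := by
  have h := unprojectedDense_polyFibredGraph_cancelling (F ∘ Equiv.swap (0 : Fin 2) 1)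
    (by simpa using hF1) r₁ r₀ hr₁ hirr.symm c (by simpa using hadm)
  rw [← unprojectedDense_compPerm_iff (Equiv.swap (0 : Fin 3) 1), polyFibredGraph_hyperplane_swap] at h
  exact h

/-- **Positive planes with the OTHER fibre polynomial nonzero** (`F₁ ≠ 0`, `F₀` arbitrary): dense,
by the swapped cancelling regime with a small exponent. (new)
[cite: MantovaMasser2023, §1 p.5 (the open case dim π(V) = 2 in ℂ³×ℂˣ³)] -/
theorem unprojectedDense_polyFibredGraph_hyperplane_pos' (F : Fin 2 → Polynomial ℂ) (hF1 : F 1 ≠ 0)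
    (r₀ r₁ : ℝ) (hr₀ : 0 < r₀) (hr₁ : 0 < r₁) (hirr : Irrational r₀ ∨ Irrational r₁) (c : ℂ) :
    UnprojectedDense (polyFibredGraph (hyperplanePoly ![r₀, r₁] c) (fun j => X j)
      (fun j => (F j).toMvPolynomial 0)) := by
  have h := unprojectedDense_polyFibredGraph_hyperplane_pos (F ∘ Equiv.swap (0 : Fin 2) 1)
    (by simpa using hF1) r₁ r₀ hr₁ hr₀ hirr.symm c
  rw [← unprojectedDense_compPerm_iff (Equiv.swap (0 : Fin 3) 1), polyFibredGraph_hyperplane_swap] at h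
  exact h

/-- **Positive planes, some fibre polynomial nonzero**: `r₀, r₁ > 0`, one irrational, `F ≠ 0`, any
`c` ⟹ `I(W ∩ Γ_exp) = I(W)`. (new) [cite: MantovaMasser2023, §1 p.5 (the open case dim π(V) = 2 in ℂ³×ℂˣ³)] -/
theorem unprojectedDense_polyFibredGraph_hyperplane_pos_of_ne_zero (F : Fin 2 → Polynomial ℂ)
    (hF : F ≠ 0) (r₀ r₁ : ℝ) (hr₀ : 0 < r₀) (hr₁ : 0 < r₁) (hirr : Irrational r₀ ∨ Irrational r₁)
    (c : ℂ) :
    UnprojectedDense (polyFibredGraph (hyperplanePoly ![r₀, r₁] c) (fun j => X j)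
      (fun j => (F j).toMvPolynomial 0)) := by
  by_cases h0 : F 0 = 0
  · have h1 : F 1 ≠ 0 := by
      intro h1
      apply hF
      funext j
      fin_cases j
      · exact h0
      · exact h1
    exact unprojectedDense_polyFibredGraph_hyperplane_pos' F h1 r₀ r₁ hr₀ hr₁ hirr c
  · exact unprojectedDense_polyFibredGraph_hyperplane_pos F h0 r₀ r₁ hr₀ hr₁ hirr c

end Swap

section Admissible

/-- An admissible exponent for `r₀ > 0 > r₁` beyond resonance (`e₀r₀ + e₁r₁ > 1`). [folklore] -/
theorem cancellingAdmissible_of_pos_neg {r₀ r₁ e₀ e₁ : ℝ} (he₀ : 0 < e₀) (he₁ : 0 < e₁)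
    (hr₀ : 0 < r₀) (hr₁ : r₁ < 0) (hS : 1 < e₀ * r₀ + e₁ * r₁) :
    ∃ β : ℝ, 0 < β ∧ β * e₁ < e₀ ∧ (β / e₀ - r₁) / r₀ < β := by
  have h1 : 1 < e₀ * r₀ := by nlinarith
  set a : ℝ := -r₁ * e₀ / (e₀ * r₀ - 1) with ha
  have ha0 : 0 ≤ a := div_nonneg (by nlinarith) (by linarith)
  have hab : a < e₀ / e₁ := by
    rw [ha, div_lt_div_iff₀ (by linarith) he₁]
    nlinarith
  refine ⟨(a + e₀ / e₁) / 2, by positivity, ?_, ?_⟩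
  · have : (a + e₀ / e₁) / 2 < e₀ / e₁ := by linarith
    calc (a + e₀ / e₁) / 2 * e₁ < e₀ / e₁ * e₁ := mul_lt_mul_of_pos_right this he₁
      _ = e₀ := by field_simp
  · rw [div_lt_iff₀ hr₀]
    have hβa : a < (a + e₀ / e₁) / 2 := by linarith
    have key : -r₁ * e₀ < (a + e₀ / e₁) / 2 * (e₀ * r₀ - 1) := by
      have := (div_lt_iff₀ (show 0 < e₀ * r₀ - 1 by linarith)).1 (by rw [← ha]; exact hβa)
      linarith
    have : ((a + e₀ / e₁) / 2 / e₀ - r₁) * e₀ < (a + e₀ / e₁) / 2 * r₀ * e₀ := by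
      rw [sub_mul, div_mul_cancel₀ _ he₀.ne']
      nlinarith
    exact lt_of_mul_lt_mul_right this he₀.le

/-- An admissible exponent for `r₀ < 0 < r₁` below resonance (`e₀r₀ + e₁r₁ < 1`). [folklore] -/
theorem cancellingAdmissible_of_neg_pos {r₀ r₁ e₀ e₁ : ℝ} (he₀ : 0 < e₀) (he₁ : 0 < e₁)
    (hr₀ : r₀ < 0) (hr₁ : 0 < r₁) (hS : e₀ * r₀ + e₁ * r₁ < 1) :
    ∃ β : ℝ, 0 < β ∧ β * e₁ < e₀ ∧ (β / e₀ - r₁) / r₀ < β := by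
  have h1 : e₀ * r₀ < 1 := by nlinarith
  set a : ℝ := e₀ * r₁ / (1 - e₀ * r₀) with ha
  have ha0 : 0 < a := div_pos (by positivity) (by linarith)
  have hab : a < e₀ / e₁ := by
    rw [ha, div_lt_div_iff₀ (by linarith) he₁]
    nlinarith
  refine ⟨(a + e₀ / e₁) / 2, by positivity, ?_, ?_⟩
  · have : (a + e₀ / e₁) / 2 < e₀ / e₁ := by linarith
    calc (a + e₀ / e₁) / 2 * e₁ < e₀ / e₁ * e₁ := mul_lt_mul_of_pos_right this he₁
      _ = e₀ := by field_simp
  · rw [div_lt_iff_of_neg hr₀]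
    have hβa : a < (a + e₀ / e₁) / 2 := by linarith
    have key : e₀ * r₁ < (a + e₀ / e₁) / 2 * (1 - e₀ * r₀) := by
      have := (div_lt_iff₀ (show 0 < 1 - e₀ * r₀ by linarith)).1 (by rw [← ha]; exact hβa)
      linarith
    have : (a + e₀ / e₁) / 2 * r₀ * e₀ < ((a + e₀ / e₁) / 2 / e₀ - r₁) * e₀ := by
      rw [sub_mul, div_mul_cancel₀ _ he₀.ne']
      nlinarith
    exact lt_of_mul_lt_mul_right this he₀.le

end Admissible

section Master

/-- **MASTER THEOREM (real planes, targets `Xⱼ`, arbitrary nonzero fibre polynomials).**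
`F₀, F₁ ≠ 0`, `r₀, r₁ ≠ 0`, one of them irrational, `c ∈ ℂ`, and OFF the resonant line with unequal
degrees and mixed signs (`hres`: if `(deg F₀ + 1)r₀ + (deg F₁ + 1)r₁ = 1` and `r₀r₁ < 0` then
`deg F₀ = deg F₁`): `W = {x₂ = r₀x₀ + r₁x₁ + c, y₀ = x₀ + y₂F₀(y₂), y₁ = x₁ + y₂F₁(y₂)}` has
`I(W ∩ Γ_exp) = I(W)`. (new) [cite: MantovaMasser2023, §1 p.5 (the open case dim π(V) = 2 in ℂ³×ℂˣ³)] -/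
theorem unprojectedDense_polyFibredGraph_hyperplane_offResonance (F : Fin 2 → Polynomial ℂ)
    (hF0 : F 0 ≠ 0) (hF1 : F 1 ≠ 0) (r₀ r₁ : ℝ) (hr₀ : r₀ ≠ 0) (hr₁ : r₁ ≠ 0)
    (hirr : Irrational r₀ ∨ Irrational r₁) (c : ℂ)
    (hres : (((F 0).natDegree + 1 : ℕ) : ℝ) * r₀ + (((F 1).natDegree + 1 : ℕ) : ℝ) * r₁ = 1 →
      r₀ * r₁ < 0 → (F 0).natDegree = (F 1).natDegree) :
    UnprojectedDense (polyFibredGraph (hyperplanePoly ![r₀, r₁] c) (fun j => X j)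
      (fun j => (F j).toMvPolynomial 0)) := by
  set e₀ : ℝ := (((F 0).natDegree + 1 : ℕ) : ℝ) with he₀def
  set e₁ : ℝ := (((F 1).natDegree + 1 : ℕ) : ℝ) with he₁def
  have he₀ : 0 < e₀ := by rw [he₀def]; positivity
  have he₁ : 0 < e₁ := by rw [he₁def]; positivity
  -- the resonant equal-degree case is the critical size of gen 14
  have hcrit : e₀ * r₀ + e₁ * r₁ = 1 → r₀ * r₁ < 0 →
      UnprojectedDense (polyFibredGraph (hyperplanePoly ![r₀, r₁] c) (fun j => X j)
        (fun j => (F j).toMvPolynomial 0)) := by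
    intro hS hsign
    have hdeg : (F 0).natDegree = (F 1).natDegree := hres hS hsign
    have he01 : e₁ = e₀ := by rw [he₀def, he₁def, hdeg]
    have hr₁eq : r₁ = 1 / e₀ - r₀ := by
      rw [he01] at hS
      field_simp
      linarith
    have hr₀irr : Irrational r₀ := by
      rcases hirr with h | h
      · exact h
      · have h' := Irrational.ratCast_sub (1 / ((F 0).natDegree + 1 : ℕ) : ℚ) h
        have : ((1 / ((F 0).natDegree + 1 : ℕ) : ℚ) : ℝ) - r₁ = r₀ := by
          rw [hr₁eq, he₀def]; push_cast; ring
        rwa [this] at h'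
    rw [hr₁eq, he₀def]
    exact unprojectedDense_polyFibredGraph_critical_fibres F hF0 (le_of_eq hdeg.symm) r₀ hr₀irr c
  rcases lt_or_gt_of_ne hr₀ with h0 | h0 <;> rcases lt_or_gt_of_ne hr₁ with h1 | h1
  · -- `r₀ < 0`, `r₁ < 0`: the slow regime (`λ = r₀ + r₁ < 0`)
    refine unprojectedDense_polyFibredGraph_hyperplane ![r₀, r₁] c ?_ (fun j => X j)
      (fun j => X_ne_zero j) F fun j => ?_
    · rcases hirr with h | h
      · exact ⟨0, by simpa using h⟩
      · exact ⟨1, by simpa using h⟩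
    · have hsum : ∑ i : Fin 2, (![r₀, r₁] : Fin 2 → ℝ) i * ((X i : MvPolynomial (Fin 2) ℂ).totalDegree : ℝ)
          = r₀ + r₁ := by
        rw [Fin.sum_univ_two]
        simp [MvPolynomial.totalDegree_X]
      rw [hsum, max_eq_right (by linarith), MvPolynomial.totalDegree_X]
      simp only [zero_mul, add_zero, Nat.cast_one]
      linarith
  · -- `r₀ < 0 < r₁`
    rcases lt_trichotomy (e₀ * r₀ + e₁ * r₁) 1 with hS | hS | hS
    · exact unprojectedDense_polyFibredGraph_cancelling F hF0 r₀ r₁ hr₀ hirr c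
        (cancellingAdmissible_of_neg_pos he₀ he₁ h0 h1 hS)
    · exact hcrit hS (by nlinarith)
    · exact unprojectedDense_polyFibredGraph_cancelling_swap F hF1 r₀ r₁ hr₁ hirr c
        (cancellingAdmissible_of_pos_neg he₁ he₀ h1 h0 (by linarith))
  · -- `r₁ < 0 < r₀`
    rcases lt_trichotomy (e₀ * r₀ + e₁ * r₁) 1 with hS | hS | hS
    · exact unprojectedDense_polyFibredGraph_cancelling_swap F hF1 r₀ r₁ hr₁ hirr c
        (cancellingAdmissible_of_neg_pos he₁ he₀ h1 h0 (by linarith))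
    · exact hcrit hS (by nlinarith)
    · exact unprojectedDense_polyFibredGraph_cancelling F hF0 r₀ r₁ hr₀ hirr c
        (cancellingAdmissible_of_pos_neg he₀ he₁ h0 h1 hS)
  · -- `r₀, r₁ > 0`
    exact unprojectedDense_polyFibredGraph_hyperplane_pos F hF0 r₀ r₁ h0 h1 hirr c

/-- **The axis `r₁ = 0`** (`x₂ = r₀x₀ + c`, `r₀ ∉ ℚ`): dense whenever `r₀ < 0` or `(deg F₀ + 1)r₀ > 1`
(the cancelling regime for the fibre `0` with `β = e₀/(2e₁)`; the second label lives in the base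
value alone: `K = ⌈m^β⌉`). (new) [cite: MantovaMasser2023, §1 p.5 (the open case dim π(V) = 2 in ℂ³×ℂˣ³)] -/
theorem unprojectedDense_polyFibredGraph_hyperplane_axis (F : Fin 2 → Polynomial ℂ) (hF0 : F 0 ≠ 0)
    (r₀ : ℝ) (hirr : Irrational r₀) (c : ℂ)
    (h : r₀ < 0 ∨ 1 < (((F 0).natDegree + 1 : ℕ) : ℝ) * r₀) :
    UnprojectedDense (polyFibredGraph (hyperplanePoly ![r₀, 0] c) (fun j => X j)
      (fun j => (F j).toMvPolynomial 0)) := by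
  have hr₀ : r₀ ≠ 0 := by
    rintro rfl
    exact hirr ⟨0, by simp⟩
  set e₀ : ℝ := (((F 0).natDegree + 1 : ℕ) : ℝ) with he₀def
  set e₁ : ℝ := (((F 1).natDegree + 1 : ℕ) : ℝ) with he₁def
  have he₀ : 0 < e₀ := by rw [he₀def]; positivity
  have he₁ : 0 < e₁ := by rw [he₁def]; positivity
  set β : ℝ := e₀ / (2 * e₁) with hβdef
  have hβ : 0 < β := by positivity
  refine unprojectedDense_polyFibredGraph_cancelling F hF0 r₀ 0 hr₀ (Or.inl hirr) c ⟨β, hβ, ?_, ?_⟩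
  · calc β * e₁ = e₀ / 2 := by rw [hβdef]; field_simp
      _ < e₀ := by linarith
  · -- `(β/e₀ - 0)/r₀ < β`: for `r₀ < 0` the left side is negative; for `e₀r₀ > 1` it is `β/(e₀r₀) < β`
    rw [sub_zero]
    rcases h with h | h
    · have : β / e₀ / r₀ < 0 := div_neg_of_pos_of_neg (div_pos hβ he₀) h
      linarith
    · have hr₀pos : 0 < r₀ := by nlinarith
      rw [div_div, div_lt_iff₀ (mul_pos he₀ hr₀pos)]
      nlinarith

/-- **Certified members off the resonant line, dense**: all seven hypotheses of `ECCell 3 2`, not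
linearly split, `W ∩ Γ_exp ≠ ∅`, `I(W ∩ Γ_exp) = I(W)`. (new)
[cite: MantovaMasser2023, §1 p.5 (the open case dim π(V) = 2 in ℂ³×ℂˣ³)] -/
theorem polyFibredGraph_hyperplane_offResonance_member_dense (F : Fin 2 → Polynomial ℂ)
    (hF0 : F 0 ≠ 0) (hF1 : F 1 ≠ 0) (r₀ r₁ : ℝ) (hr₀ : r₀ ≠ 0) (hr₁ : r₁ ≠ 0)
    (hirr : Irrational r₀ ∨ Irrational r₁) (c : ℂ)
    (hres : (((F 0).natDegree + 1 : ℕ) : ℝ) * r₀ + (((F 1).natDegree + 1 : ℕ) : ℝ) * r₁ = 1 →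
      r₀ * r₁ < 0 → (F 0).natDegree = (F 1).natDegree) :
    (IsIrreducibleClosed ℂ (polyFibredGraph (hyperplanePoly ![r₀, r₁] c) (fun j => X j)
        (fun j => (F j).toMvPolynomial 0)) ∧
      (polyFibredGraph (hyperplanePoly ![r₀, r₁] c) (fun j => X j) (fun j => (F j).toMvPolynomial 0) ∩
          torusLocus ℂ 3).Nonempty ∧
      IsRotund ℂ 3 (polyFibredGraph (hyperplanePoly ![r₀, r₁] c) (fun j => X j)
          (fun j => (F j).toMvPolynomial 0) ∩ torusLocus ℂ 3) ∧
      IsAddFree ℂ 3 (polyFibredGraph (hyperplanePoly ![r₀, r₁] c) (fun j => X j)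
          (fun j => (F j).toMvPolynomial 0) ∩ torusLocus ℂ 3) ∧
      IsMulFree ℂ 3 (polyFibredGraph (hyperplanePoly ![r₀, r₁] c) (fun j => X j)
          (fun j => (F j).toMvPolynomial 0) ∩ torusLocus ℂ 3) ∧
      zariskiDim ℂ (polyFibredGraph (hyperplanePoly ![r₀, r₁] c) (fun j => X j)
          (fun j => (F j).toMvPolynomial 0)) = (3 : ℕ) ∧
      addProjDim ℂ 3 (polyFibredGraph (hyperplanePoly ![r₀, r₁] c) (fun j => X j)
          (fun j => (F j).toMvPolynomial 0)) = (2 : ℕ)) ∧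
    ¬ IsLinearSplit ℂ 3 (polyFibredGraph (hyperplanePoly ![r₀, r₁] c) (fun j => X j)
        (fun j => (F j).toMvPolynomial 0)) ∧
    (polyFibredGraph (hyperplanePoly ![r₀, r₁] c) (fun j => X j) (fun j => (F j).toMvPolynomial 0) ∩
        expGraph ℂ 3).Nonempty ∧
    UnprojectedDense (polyFibredGraph (hyperplanePoly ![r₀, r₁] c) (fun j => X j)
        (fun j => (F j).toMvPolynomial 0)) := by
  have hA : Function.Injective (aeval (fun j : Fin 2 => (X j : MvPolynomial (Fin 2) ℂ)) :
      MvPolynomial (Fin 2) ℂ →ₐ[ℂ] MvPolynomial (Fin 2) ℂ) := by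
    rw [aeval_X_left]; exact fun _ _ h => h
  have hirr' : ∃ i : Fin 2, Irrational ((![r₀, r₁] : Fin 2 → ℝ) i) := by
    rcases hirr with h | h
    · exact ⟨0, by simpa using h⟩
    · exact ⟨1, by simpa using h⟩
  have hcell := ecCell_hypotheses_polyFibredGraph_hyperplane ![r₀, r₁] c (fun j => X j)
    (fun j => (F j).toMvPolynomial 0) hA hirr'
  have hdense := unprojectedDense_polyFibredGraph_hyperplane_offResonance F hF0 hF1 r₀ r₁ hr₀ hr₁
    hirr c hres
  refine ⟨hcell, not_isLinearSplit_polyFibredGraph _ (fun j => X j) _ (by norm_num) hA, ?_, hdense⟩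
  obtain ⟨w, hw, -⟩ := hcell.2.1
  exact inter_expGraph_nonempty_of_vanishingIdeal_eq ⟨w, hw⟩ hdense

/-- **A mixed-sign super-critical member, dense**: `W = {x₂ = √2x₀ - x₁/2, y₀ = x₀ + y₂², y₁ = x₁ + y₂}`
(`e₀r₀ + e₁r₁ = 2√2 - 1/2 ≠ 1`; along lattice rays `|y₂²| ≍ m^{1.83}` against targets `≍ m`): all
seven hypotheses of `ECCell 3 2`, not linearly split, `W ∩ Γ_exp ≠ ∅`, `I(W ∩ Γ_exp) = I(W)`. (new)
[cite: MantovaMasser2023, §1 p.5 (the open case dim π(V) = 2 in ℂ³×ℂˣ³)] -/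
theorem sqrtTwoNegHalf_member_dense :
    let F : Fin 2 → Polynomial ℂ := ![Polynomial.X, 1]
    let W := polyFibredGraph (hyperplanePoly ![Real.sqrt 2, -(1 / 2)] 0) (fun j => X j)
      (fun j => (F j).toMvPolynomial 0)
    (IsIrreducibleClosed ℂ W ∧ (W ∩ torusLocus ℂ 3).Nonempty ∧ IsRotund ℂ 3 (W ∩ torusLocus ℂ 3) ∧
        IsAddFree ℂ 3 (W ∩ torusLocus ℂ 3) ∧ IsMulFree ℂ 3 (W ∩ torusLocus ℂ 3) ∧
        zariskiDim ℂ W = (3 : ℕ) ∧ addProjDim ℂ 3 W = (2 : ℕ)) ∧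
      ¬ IsLinearSplit ℂ 3 W ∧ (W ∩ expGraph ℂ 3).Nonempty ∧ UnprojectedDense W := by
  refine polyFibredGraph_hyperplane_offResonance_member_dense ![Polynomial.X, 1] (by simp) (by simp)
    (Real.sqrt 2) (-(1 / 2)) (Real.sqrt_pos.2 two_pos).ne' (by norm_num) (Or.inl irrational_sqrt_two)
    0 ?_
  intro hS _
  exfalso
  simp only [Matrix.cons_val_zero, Matrix.cons_val_one, Polynomial.natDegree_X,
    Polynomial.natDegree_one] at hS
  -- `2√2 - 1/2 = 1` is impossible: `√2 = 3/4` contradicts `(√2)² = 2`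
  have h2 : Real.sqrt 2 * Real.sqrt 2 = 2 := Real.mul_self_sqrt two_pos.le
  push_cast at hS
  nlinarith

end Master

end Summit.Schanuel.Schanuel.Theorems

end
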